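import Literature.AlgebraicGeometry.Resolution.ExtAnnihilatorLocalization
import HarnessLib

/-!
# `Ext`-annihilators under base change to `R_𝔭` (any model of the localized module)

Topic: `Literature/AlgebraicGeometry/Resolution` (generalization of `ExtAnnihilatorLocalization.lean`
needed for the GLOBAL (affine, non-local) `Ext`-annihilator ideal: the local rings `A_𝔓` of
`A = B/I` are base changes `F.baseChange B_𝔭 φ hφ` of a resolution `F` of `A` over `B` along
`φ : A → A_𝔓`, not literally `F.localize 𝔭`).

* `FreeResolution.smul_dual_mem_BSub_baseChange`, `map_annihilator_EMod_baseChange_le`,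
  `map_prod_annihilator_EMod_baseChange_le` — `(Ann_R E^{q+1}(F)) R_𝔭 ⊆ Ann_{R_𝔭} E^{q+1}(F ⊗ R_𝔭)`
  for `F ⊗ R_𝔭` modelled on ANY base change `φ : M → N'` to `R_𝔭` (`IsBaseChange`).
[cite: Matsumura1987, §19 Lemma 4]
-/

noncomputable section

open CategoryTheory IsLocalRing Module

universe u

namespace Literature.AlgebraicGeometry.Resolution

namespace FreeResolution

section BaseChange

variable {R : Type u} [CommRing R] [IsNoetherianRing R] {M : Type u} [AddCommGroup M] [Module R M]
variable (F : FreeResolution R M) (𝔭 : Ideal R) [𝔭.IsPrime]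
variable {N' : Type u} [AddCommGroup N'] [Module R N'] [Module (Localization.AtPrime 𝔭) N']
  [IsScalarTower R (Localization.AtPrime 𝔭) N'] (φ : M →ₗ[R] N')
  (hφ : IsBaseChange (Localization.AtPrime 𝔭) φ)

/-- **Localising an annihilator of `E^{q+1}`, any model of `M_𝔭`.** If `z ∈ Ann_R E^{q+1}(F)` then
for every linear form `ψ'` on the syzygy of the base-changed resolution `F ⊗ R_𝔭` (modelled on a
base change `φ : M → N'`), `(z/1)ψ' ∈ B^{q+1}(F ⊗ R_𝔭)`. [folklore] -/
theorem smul_dual_mem_BSub_baseChange (q : ℕ) {z : R}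
    (hz : z ∈ Module.annihilator R (F.EMod (q + 1)))
    (ψ' : Dual (Localization.AtPrime 𝔭) ((F.baseChange (Localization.AtPrime 𝔭) φ hφ).syzygyObj (q + 1))) :
    algebraMap R (Localization.AtPrime 𝔭) z • ψ' ∈ (F.baseChange (Localization.AtPrime 𝔭) φ hφ).BSub (q + 1) := by
  have hη := F.isBaseChange_syzygyMap (Localization.AtPrime 𝔭) φ hφ q
  -- the `R`-linear form `y ↦ ψ'(y/1)` on `K_{q+1}` with values in `R_𝔭`; clear denominators
  let g : F.syzygy q →ₗ[R] (Localization.AtPrime 𝔭) :=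
    (ψ'.restrictScalars R) ∘ₗ
      ((((F.baseChange (Localization.AtPrime 𝔭) φ hφ).syzygySuccEquiv q).symm.toLinearMap.restrictScalars R) ∘ₗ
        F.syzygyMap (Localization.AtPrime 𝔭) φ hφ q)
  have hg : ∀ y, g y = ψ' (((F.baseChange (Localization.AtPrime 𝔭) φ hφ).syzygySuccEquiv q).symm
      (F.syzygyMap (Localization.AtPrime 𝔭) φ hφ q y)) := fun _ => rfl
  haveI : Module.FinitePresentation R (F.syzygy q) := Module.finitePresentation_of_finite R _
  obtain ⟨ψ, s, hψs⟩ := Module.FinitePresentation.exists_lift_of_isLocalizedModule 𝔭.primeCompl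
    (f := Algebra.linearMap R (Localization.AtPrime 𝔭)) g
  have hψ : ∀ y, algebraMap R (Localization.AtPrime 𝔭) (ψ y) = algebraMap R (Localization.AtPrime 𝔭) s * g y := fun y => by
    have h0 := LinearMap.congr_fun hψs y
    simp only [LinearMap.coe_comp, Function.comp_apply, Algebra.linearMap_apply,
      LinearMap.smul_apply] at h0
    rw [h0, Submonoid.smul_def, Algebra.smul_def]
  -- upstairs: `z ψ ∈ B^{q+1}(F)`, i.e. `z ψ = θ ∘ ι`
  have hzψ : z • (ψ ∘ₗ (F.syzygySuccEquiv q).toLinearMap : Dual R (F.syzygyObj (q + 1))) ∈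
      F.BSub (q + 1) := by
    have h0 := Module.mem_annihilator.mp hz
      (Submodule.Quotient.mk (ψ ∘ₗ (F.syzygySuccEquiv q).toLinearMap))
    rwa [← Submodule.Quotient.mk_smul, Submodule.Quotient.mk_eq_zero] at h0
  obtain ⟨θ, hθ⟩ := (F.mem_BSub_succ_iff q _).mp hzψ
  have hθy : ∀ y : F.syzygy q, θ (y : Fin (F.rank q) → R) = z * ψ y := fun y =>
    LinearMap.congr_fun hθ y
  -- base change `θ` to `θ' : (F_q)_𝔭 → R_𝔭`
  let θ' : (Fin (F.rank q) → (Localization.AtPrime 𝔭)) →ₗ[(Localization.AtPrime 𝔭)] (Localization.AtPrime 𝔭) :=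
    (isBaseChange_piAlgebraMap R (Localization.AtPrime 𝔭) (F.rank q)).lift (Algebra.linearMap R (Localization.AtPrime 𝔭) ∘ₗ θ)
  have hθ' : ∀ v, θ' (piAlgebraMap R (Localization.AtPrime 𝔭) (F.rank q) v) = algebraMap R (Localization.AtPrime 𝔭) (θ v) := fun v =>
    (isBaseChange_piAlgebraMap R (Localization.AtPrime 𝔭) (F.rank q)).lift_eq _ v
  -- `θ' ∘ ι' = (s z / 1) ψ'` on `(K_{q+1})_𝔭`: check on the generators `y/1`
  have key : ((F.baseChange (Localization.AtPrime 𝔭) φ hφ).dualRestrict q θ') ∘ₗ ((F.baseChange (Localization.AtPrime 𝔭) φ hφ).syzygySuccEquiv q).symm.toLinearMap =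
      ((algebraMap R (Localization.AtPrime 𝔭) s * algebraMap R (Localization.AtPrime 𝔭) z) • ψ') ∘ₗ ((F.baseChange (Localization.AtPrime 𝔭) φ hφ).syzygySuccEquiv q).symm.toLinearMap := by
    refine hη.algHom_ext _ _ fun y => ?_
    rw [LinearMap.comp_apply, LinearMap.comp_apply, dualRestrict_apply, LinearMap.smul_apply]
    have h1 : ((F.baseChange (Localization.AtPrime 𝔭) φ hφ).syzygyι q).hom (((F.baseChange (Localization.AtPrime 𝔭) φ hφ).syzygySuccEquiv q).symm.toLinearMap
        (F.syzygyMap (Localization.AtPrime 𝔭) φ hφ q y)) =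
        piAlgebraMap R (Localization.AtPrime 𝔭) (F.rank q) (y : Fin (F.rank q) → R) := rfl
    rw [h1, hθ', hθy, map_mul, hψ, smul_eq_mul]
    change algebraMap R (Localization.AtPrime 𝔭) z * (algebraMap R (Localization.AtPrime 𝔭) s * g y) =
      (algebraMap R (Localization.AtPrime 𝔭) s * algebraMap R (Localization.AtPrime 𝔭) z) * g y
    ring
  have hpt : ∀ x, (F.baseChange (Localization.AtPrime 𝔭) φ hφ).dualRestrict q θ' x = (algebraMap R (Localization.AtPrime 𝔭) s * algebraMap R (Localization.AtPrime 𝔭) z) • ψ' x :=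
    fun x => by
      have h0 := LinearMap.congr_fun key ((F.baseChange (Localization.AtPrime 𝔭) φ hφ).syzygySuccEquiv q x)
      simpa only [LinearMap.comp_apply, LinearEquiv.coe_toLinearMap,
        LinearEquiv.symm_apply_apply, LinearMap.smul_apply] using h0
  -- divide by the unit `s/1`
  have hunit : IsUnit (algebraMap R (Localization.AtPrime 𝔭) s) := IsLocalization.map_units (Localization.AtPrime 𝔭) s
  refine ((F.baseChange (Localization.AtPrime 𝔭) φ hφ).mem_BSub_succ_iff q _).mpr ⟨((hunit.unit⁻¹ : (Localization.AtPrime 𝔭)ˣ) : (Localization.AtPrime 𝔭)) • θ', ?_⟩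
  ext x
  rw [LinearMap.map_smul, LinearMap.smul_apply, hpt, smul_smul, ← mul_assoc,
    IsUnit.val_inv_mul, one_mul, LinearMap.smul_apply]

/-- `(Ann_R E^{q+1}(F)) · R_𝔭 ⊆ Ann_{R_𝔭} E^{q+1}(F ⊗ R_𝔭)` for any model of the base change.
[cite: Matsumura1987, §19 Lemma 4] -/
theorem map_annihilator_EMod_baseChange_le (q : ℕ) :
    (Module.annihilator R (F.EMod (q + 1))).map (algebraMap R (Localization.AtPrime 𝔭)) ≤
      Module.annihilator (Localization.AtPrime 𝔭)
        ((F.baseChange (Localization.AtPrime 𝔭) φ hφ).EMod (q + 1)) := by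
  refine Ideal.map_le_iff_le_comap.mpr fun z hz => ?_
  rw [Ideal.mem_comap, Module.mem_annihilator]
  intro e
  induction e using Submodule.Quotient.induction_on with
  | H ψ' =>
    rw [← Submodule.Quotient.mk_smul, Submodule.Quotient.mk_eq_zero]
    exact F.smul_dual_mem_BSub_baseChange 𝔭 φ hφ q hz ψ'

/-- The products over positive indices, any model of the base change. [folklore] -/
theorem map_prod_annihilator_EMod_baseChange_le (T : Finset ℕ) (hT : ∀ q ∈ T, 1 ≤ q) :
    (∏ q ∈ T, Module.annihilator R (F.EMod q)).map (algebraMap R (Localization.AtPrime 𝔭)) ≤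
      ∏ q ∈ T, Module.annihilator (Localization.AtPrime 𝔭)
        ((F.baseChange (Localization.AtPrime 𝔭) φ hφ).EMod q) := by
  classical
  induction T using Finset.induction_on with
  | empty => simp
  | insert a T haT ih =>
    rw [Finset.prod_insert haT, Finset.prod_insert haT, Ideal.map_mul]
    refine Ideal.mul_mono ?_ (ih fun q hq => hT q (Finset.mem_insert_of_mem hq))
    obtain ⟨a', rfl⟩ : ∃ a', a = a' + 1 := ⟨a - 1, by have := hT a (Finset.mem_insert_self a T); omega⟩
    exact F.map_annihilator_EMod_baseChange_le 𝔭 φ hφ a'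

end BaseChange

end FreeResolution

end Literature.AlgebraicGeometry.Resolution

end
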